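import Summits.QuantumAdvantage.QuantumAdvantage.Theorems.CubicForrelationNearExactIsExactTwelveTypeOW8

/-!
# Crux `CubicForrelation.NearExactIsExact` (stmt-QuantumAdvantage-14043) — n = 12, type O at `Φ ≥ 934/1024`: the base set `928` is impossible,
  and a type-O side has `#E = 912` with excess `≤ 128`

Certificate seat `b2b-cforr-cert` (gen 18).  HONEST FRAMING: kernel-checked lemmas (standard axioms) for the type-O branch of the NEXT rung `934/1024`
(not closed here: the case `#E = 912` with a non-zero wild function of energy `≤ 8` remains — see HOME/b2b-cforr-cert-g18/PROOF-N12-935.md);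
NO new value of `θ₁₂`.  NOT summit progress.
* `to18_typeO_E928_ge934_false`: `#E = 928` at `Φ ≥ 934/1024` has zero excess (`4096 + 8·928 = 11520 = 2¹⁷(1 − 934/1024)`), and then Walsh
  inversion at the character point gives `u_f(c₁) = 4(−1)^{g(c₁)} ∓ 6` (`928 = 16·58`): even, so `f` is not type O, and `u_f(c₁)/2 = 2(−1)^g ∓ 3`
  is odd, so `f` is at level 5 — dead above `932/1024` (`tw15_levelFive_932_false`).
* `to18_typeO_ge934_shape`: a type-O side with `Φ ≥ 934/1024` has `#E = 912` and excess `Σ X ≤ 128` (so `Σ v² ≤ 8`): `896 < #E < 960`, `8 ∣ #E`;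
  `#E ≡ 8 (mod 16)` costs `≥ 256` (`to18_typeO_w8_budget`) while the budget leaves `7424 − 8·#E ≤ 192`; `#E = 928` is the previous lemma;
  `#E ≥ 944` exceeds the budget.
References: Ax (1964) / McEliece (1972); MacWilliams–Sloane (1977) Ch. 15.  Axioms: the standard three.
-/

set_option linter.dupNamespace false -- D-0017: single-problem summit ⇒ `QuantumAdvantage.QuantumAdvantage` by design

noncomputable section

namespace Summit.QuantumAdvantage.QuantumAdvantage.Theorems.CubicForrelation.NearExactIsExact

open Finset
open Literature.Computability.QuantumComplexity
open Literature.Computability.QuantumComplexity.BuzetChailloux (bxor zeroVec bxor_bxor_cancel_left bxor_zeroVec zeroVec_bxor bxor_comm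
  bxor_self twist_zeroVec_right twist_bxor_right signOf_sq)
open Literature.Computability.QuantumComplexity.DerivativeWalsh (W sum_W_sq)
open Literature.Computability.QuantumComplexity.Simon (twist_eq_one_or)
open Summit.QuantumAdvantage.QuantumAdvantage.Theorems.NearExactIsExact.Negative (TypeOTwelve.typeO_of_exists_odd)

/-- **No type-O base set of `928` points at `Φ ≥ 934/1024`.**  See the module docstring.  NOT summit progress. [this work] -/
theorem to18_typeO_E928_ge934_false (f g : (Fin (6 + 6) → Bool) → Bool) (hf : IsDegLeFun 3 f) (hg : IsDegLeFun 3 g)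
    (u : (Fin (6 + 6) → Bool) → ℤ) (hu : ∀ x, W (fun y => signOf (g y)) x = (2 : ℝ) ^ 4 * (u x : ℝ))
    (hodd : ∃ x, Odd (u x)) (hE : #(univ.filter fun x : Fin (6 + 6) → Bool => (Odd (u x / 2) ↔ Odd (u x / 2 / 2))) = 928)
    (hΦ : (934 / 1024 : ℝ) ≤ forrelation f g) : False := by
  classical
  have hall : ∀ x, Odd (u x) := TypeOTwelve.typeO_of_exists_odd g u hg hu hodd
  have hu' : ∀ x, W (fun y => signOf (g y)) x = (2 : ℝ) ^ (2 * 2) * (u x : ℝ) := fun x => (hu x).trans (by norm_num)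
  have hd1 : IsDegLeFun 1 (fun x => decide (Odd (u x / 2))) := z2_digitOne 2 g u hg hu' hall
  set E := univ.filter (fun x : Fin (6 + 6) → Bool => (Odd (u x / 2) ↔ Odd (u x / 2 / 2))) with hEdef
  -- base pattern; zero excess from the budget `Σ τ² ≤ 11520 = 4096 + 8·928`
  set τ₀ : (Fin (6 + 6) → Bool) → ℤ := fun x =>
    sZ (decide (Odd (u x / 2))) * (1 - 4 * (if (Odd (u x / 2) ↔ Odd (u x / 2 / 2)) then 1 else 0)) with hτ₀def
  have hsumE : (∑ x, (if (Odd (u x / 2) ↔ Odd (u x / 2 / 2)) then 1 else 0 : ℤ)) = #E := by rw [sum_boole]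
  have hbud := tw12_budget f g u hu
  have hT : (∑ x, (u x - 4 * sZ (f x)) ^ 2 : ℤ) ≤ 11520 := by
    have h' : ((∑ x, (u x - 4 * sZ (f x)) ^ 2 : ℤ) : ℝ) ≤ 11520 := by rw [hbud]; linarith
    exact_mod_cast h'
  choose v hv using fun x => to12_pt_mod8 (u x) (sZ (f x)) (hall x) (tp_sZ_cases (f x))
  have hvx : ∀ x, u x - 4 * sZ (f x) = τ₀ x + 8 * v x := fun x => hv x
  have hτ₀val : ∀ x, τ₀ x = 1 ∨ τ₀ x = -1 ∨ τ₀ x = 3 ∨ τ₀ x = -3 := by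
    intro x
    simp only [τ₀]
    rcases tp_sZ_cases (decide (Odd (u x / 2))) with h | h <;> rw [h] <;> split_ifs <;> norm_num
  have hτ₀sq : ∀ x, τ₀ x ^ 2 = 1 + 8 * (if (Odd (u x / 2) ↔ Odd (u x / 2 / 2)) then 1 else 0 : ℤ) := by
    intro x
    simp only [τ₀]
    rcases tp_sZ_cases (decide (Odd (u x / 2))) with h | h <;> rw [h] <;> split_ifs <;> norm_num
  have hsumτ₀ : ∑ x, τ₀ x ^ 2 = 11520 := by
    rw [sum_congr rfl fun x _ => hτ₀sq x, sum_add_distrib, ← mul_sum, hsumE, sum_const, card_univ, Fintype.card_fun,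
      Fintype.card_bool, Fintype.card_fin]
    change (4096 : ℕ) • (1 : ℤ) + 8 * ((#E : ℕ) : ℤ) = 11520
    rw [hE]; norm_num
  have hXnn : ∀ x, 0 ≤ (τ₀ x + 8 * v x) ^ 2 - τ₀ x ^ 2 := fun x => to12_excess_nonneg _ _ (hτ₀val x)
  have hTdec : (∑ x, (u x - 4 * sZ (f x)) ^ 2 : ℤ) = ∑ x, τ₀ x ^ 2 + ∑ x, ((τ₀ x + 8 * v x) ^ 2 - τ₀ x ^ 2) := by
    rw [← sum_add_distrib]
    exact sum_congr rfl fun x _ => by rw [hvx x]; ring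
  have hX0 : ∀ x, (τ₀ x + 8 * v x) ^ 2 - τ₀ x ^ 2 = 0 := by
    have hz : ∑ x, ((τ₀ x + 8 * v x) ^ 2 - τ₀ x ^ 2) = 0 := by
      apply le_antisymm _ (sum_nonneg fun x _ => hXnn x)
      linarith
    intro x
    exact (sum_eq_zero_iff_of_nonneg fun y _ => hXnn y).1 hz x (mem_univ x)
  have hτ : ∀ x, u x - 4 * sZ (f x) = τ₀ x := by
    intro x
    have hv0 : v x = 0 := by
      by_contra hne
      have h1 : 1 ≤ v x ∨ v x ≤ -1 := by omega
      have h2 := to12_excess _ _ 1 (hτ₀val x) le_rfl h1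
      have h3 := hX0 x
      linarith
    rw [hvx x, hv0]; ring
  obtain ⟨c₁, b₁, hcb⟩ := stub_affineForm (6 + 6) _ hd1
  have hsb : signOf b₁ = 1 ∨ signOf b₁ = -1 := by cases b₁ <;> simp [signOf]
  set cE : (Fin (6 + 6) → Bool) → Bool := fun x => (decide (Odd (u x / 2)) ^^ decide (Odd (u x / 2 / 2))) ^^ true with hcEdef
  have hsetE : (univ.filter fun x : Fin (6 + 6) → Bool => cE x = true) = E := by
    rw [hEdef]
    apply filter_congr
    intro x _
    simp only [cE]
    by_cases h1 : Odd (u x / 2) <;> by_cases h2 : Odd (u x / 2 / 2) <;> simp [h1, h2]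
  have hcEiff : ∀ x, cE x = true ↔ (Odd (u x / 2) ↔ Odd (u x / 2 / 2)) := by
    intro x; simp only [cE]; by_cases h1 : Odd (u x / 2) <;> by_cases h2 : Odd (u x / 2 / 2) <;> simp [h1, h2]
  have hτ₀R : ∀ x, (τ₀ x : ℝ) = signOf b₁ * twist c₁ x * (1 - 4 * (if cE x = true then 1 else 0)) := by
    intro x
    simp only [τ₀]
    push_cast
    rw [tp_sZ_cast, hcb x]
    by_cases h : (Odd (u x / 2) ↔ Odd (u x / 2 / 2))
    · rw [if_pos h, if_pos ((hcEiff x).2 h)]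
    · rw [if_neg h, if_neg (fun h' => h ((hcEiff x).1 h'))]
  -- the partner at the Ax level and the inversion at `y = c₁`
  obtain ⟨uf, huf⟩ := tw_base (n := 6 + 6) f hf 4 (by norm_num)
  have hinvg : ∑ x, (u x : ℝ) * twist x c₁ = 256 * signOf (g c₁) := by
    have h := tz_inversion (fun y => signOf (g y)) c₁
    rw [sum_congr rfl fun x _ => by rw [hu x]] at h
    have h' : (2 : ℝ) ^ 4 * ∑ x, (u x : ℝ) * twist x c₁ = 2 ^ (6 + 6) * signOf (g c₁) := by
      rw [mul_sum]; rw [← h]; exact sum_congr rfl fun x _ => by ring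
    have e16 : (2 : ℝ) ^ (6 + 6) = 2 ^ 4 * 256 := by norm_num
    rw [e16, mul_assoc] at h'
    exact mul_left_cancel₀ (by positivity) h'
  have h64 : 64 * (uf c₁ : ℝ) = 256 * signOf (g c₁) - ∑ x, (τ₀ x : ℝ) * twist x c₁ := by
    have hW4 : 4 * W (fun x => signOf (f x)) c₁ = ∑ x, 4 * (signOf (f x) * twist x c₁) := by unfold W; rw [mul_sum]
    have e64 : 64 * (uf c₁ : ℝ) = 4 * W (fun x => signOf (f x)) c₁ := by rw [huf c₁]; ring
    rw [e64, hW4, ← hinvg, ← sum_sub_distrib]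
    refine sum_congr rfl fun x _ => ?_
    have h' : ((u x : ℤ) : ℝ) - 4 * (sZ (f x) : ℝ) = (τ₀ x : ℝ) := by exact_mod_cast hτ x
    rw [tp_sZ_cast] at h'
    have : (4 : ℝ) * signOf (f x) = (u x : ℝ) - (τ₀ x : ℝ) := by linarith
    rw [show (4 : ℝ) * (signOf (f x) * twist x c₁) = (4 * signOf (f x)) * twist x c₁ by ring, this]; ring
  have hτ₀c₁ : ∑ x, (τ₀ x : ℝ) * twist x c₁ = signOf b₁ * 384 := by
    have e1 : ∀ x, (τ₀ x : ℝ) * twist x c₁ = signOf b₁ * (1 - 4 * (if cE x = true then (1 : ℝ) else 0)) := by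
      intro x
      rw [hτ₀R x, twist_comm x c₁]
      rcases twist_eq_one_or c₁ x with ht | ht <;> rw [ht] <;> ring
    rw [sum_congr rfl fun x _ => e1 x, ← mul_sum, sum_sub_distrib, sum_const, card_univ, Fintype.card_fun, Fintype.card_bool,
      Fintype.card_fin, ← mul_sum, sum_boole, hsetE, hE]
    norm_num
  -- `u_f(c₁) = 4(−1)^{g(c₁)} − 6·signOf b₁`: even, and `u_f(c₁)/2` odd
  have hsg : signOf (g c₁) = 1 ∨ signOf (g c₁) = -1 := by cases g c₁ <;> simp [signOf]
  have hufc₁ : (uf c₁ : ℝ) = 4 * signOf (g c₁) - 6 * signOf b₁ := by rw [hτ₀c₁] at h64; linarith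
  have hufZ : uf c₁ = 4 * sZ (g c₁) - 6 * sZ b₁ := by
    have h' : ((uf c₁ : ℤ) : ℝ) = ((4 * sZ (g c₁) - 6 * sZ b₁ : ℤ) : ℝ) := by push_cast; rw [tp_sZ_cast, tp_sZ_cast]; exact hufc₁
    exact_mod_cast h'
  -- `f` is not type O (an even value), hence at level `≥ 5`; `u_f(c₁)/2` is odd: level 5, dead above `932/1024`
  have hΦ' : forrelation g f = forrelation f g := by
    rw [Summit.QuantumAdvantage.QuantumAdvantage.Theorems.SignedCubicForrelationNotPrBPP.Negative.HalfQuad.forrelation_comm]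
  have hfev : ∀ y, ¬ Odd (uf y) := by
    intro y hy
    have hallf := TypeOTwelve.typeO_of_exists_odd f uf hf huf ⟨y, hy⟩
    have h1 := hallf c₁
    rw [hufZ] at h1
    rcases tp_sZ_cases (g c₁) with h | h <;> rcases tp_sZ_cases b₁ with h' | h' <;> rw [h, h'] at h1 <;> revert h1 <;> decide
  have huf' : ∀ x, W (fun y => signOf (f y)) x = (2 : ℝ) ^ 5 * (((uf x / 2 : ℤ)) : ℝ) := fun x => by
    rw [tw_level_up f uf huf hfev x]
  have hodd5 : Odd (uf c₁ / 2) := by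
    rw [hufZ]
    rcases tp_sZ_cases (g c₁) with h | h <;> rcases tp_sZ_cases b₁ with h' | h' <;> rw [h, h'] <;> decide
  exact tw15_levelFive_932_false g f hg hf (fun x => uf x / 2) huf' ⟨c₁, hodd5⟩ (by rw [hΦ']; linarith)

/-- **Shape of a type-O side at `Φ ≥ 934/1024`: base set `912`, excess `≤ 128`.**  See the module docstring.  NOT summit progress. [this work] -/
theorem to18_typeO_ge934_shape (f g : (Fin (6 + 6) → Bool) → Bool) (hf : IsDegLeFun 3 f) (hg : IsDegLeFun 3 g)
    (u : (Fin (6 + 6) → Bool) → ℤ) (hu : ∀ x, W (fun y => signOf (g y)) x = (2 : ℝ) ^ 4 * (u x : ℝ))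
    (hodd : ∃ x, Odd (u x)) (hΦ : (934 / 1024 : ℝ) ≤ forrelation f g) :
    #(univ.filter fun x : Fin (6 + 6) → Bool => (Odd (u x / 2) ↔ Odd (u x / 2 / 2))) = 912 ∧
    (∑ x, (u x - 4 * sZ (f x)) ^ 2 : ℤ) ≤ 11520 := by
  classical
  have hall : ∀ x, Odd (u x) := TypeOTwelve.typeO_of_exists_odd g u hg hu hodd
  have hu' : ∀ x, W (fun y => signOf (g y)) x = (2 : ℝ) ^ (2 * 2) * (u x : ℝ) := fun x => (hu x).trans (by norm_num)
  have hd1 : IsDegLeFun 1 (fun x => decide (Odd (u x / 2))) := z2_digitOne 2 g u hg hu' hall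
  have hd2 : IsDegLeFun 3 (fun x => decide (Odd (u x / 2 / 2))) := z2_digitTwo 2 g u hg hu' hall
  set E := univ.filter (fun x : Fin (6 + 6) → Bool => (Odd (u x / 2) ↔ Odd (u x / 2 / 2))) with hEdef
  have hdegE : IsDegLeFun (2 + 1) (fun x => (decide (Odd (u x / 2)) ^^ decide (Odd (u x / 2 / 2))) ^^ true) :=
    tb_isDegLeFun_xor_const (bb_isDegLeFun_bxor (hd1.mono (by norm_num)) hd2) true
  have hsetE : (univ.filter fun x : Fin (6 + 6) → Bool =>
      ((decide (Odd (u x / 2)) ^^ decide (Odd (u x / 2 / 2))) ^^ true) = true) = E := by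
    rw [hEdef]
    apply filter_congr
    intro x _
    by_cases h1 : Odd (u x / 2) <;> by_cases h2 : Odd (u x / 2 / 2) <;> simp [h1, h2]
  have hsumE : (∑ x, (if (Odd (u x / 2) ↔ Odd (u x / 2 / 2)) then 1 else 0 : ℤ)) = #E := by rw [sum_boole]
  obtain ⟨hElo, hEhi⟩ := to18_typeO_gt932_weight f g hf hg u hu hodd (by linarith)
  change 896 < #E at hElo
  change #E < 960 at hEhi
  have hE8 : 8 ∣ #E := by
    obtain ⟨uE, huE⟩ := tw_base (n := 6 + 6) _ hdegE 4 (by norm_num)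
    have hW0 : W (fun y => signOf ((decide (Odd (u y / 2)) ^^ decide (Odd (u y / 2 / 2))) ^^ true)) zeroVec =
        4096 - 2 * (#E : ℝ) := by
      unfold W
      rw [sum_congr rfl fun y _ => by rw [twist_zeroVec_right, mul_one]]
      have e1 : ∀ y, signOf ((decide (Odd (u y / 2)) ^^ decide (Odd (u y / 2 / 2))) ^^ true) =
          1 - 2 * (if ((decide (Odd (u y / 2)) ^^ decide (Odd (u y / 2 / 2))) ^^ true) = true then (1 : ℝ) else 0) := fun y => by
        unfold signOf; cases ((decide (Odd (u y / 2)) ^^ decide (Odd (u y / 2 / 2))) ^^ true) <;> norm_num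
      rw [sum_congr rfl fun y _ => e1 y, sum_sub_distrib, sum_const, card_univ, Fintype.card_fun, Fintype.card_bool, Fintype.card_fin,
        ← mul_sum, sum_boole, hsetE]
      norm_num
    have h := huE zeroVec
    rw [hW0] at h
    have h' : ((#E : ℕ) : ℝ) = 2048 - 8 * (uE zeroVec : ℝ) := by norm_num at h ⊢; linarith
    have h'' : ((#E : ℕ) : ℤ) = 2048 - 8 * uE zeroVec := by exact_mod_cast h'
    have : (8 : ℤ) ∣ ((#E : ℕ) : ℤ) := ⟨256 - uE zeroVec, by rw [h'']; ring⟩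
    exact_mod_cast this
  -- budget
  have hbud := tw12_budget f g u hu
  have hT : (∑ x, (u x - 4 * sZ (f x)) ^ 2 : ℤ) ≤ 11520 := by
    have h' : ((∑ x, (u x - 4 * sZ (f x)) ^ 2 : ℤ) : ℝ) ≤ 11520 := by rw [hbud]; linarith
    exact_mod_cast h'
  refine ⟨?_, hT⟩
  -- lower bound `Σ τ² ≥ 4096 + 8#E`
  choose v hv using fun x => to12_pt_mod8 (u x) (sZ (f x)) (hall x) (tp_sZ_cases (f x))
  set τ₀ : (Fin (6 + 6) → Bool) → ℤ := fun x =>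
    sZ (decide (Odd (u x / 2))) * (1 - 4 * (if (Odd (u x / 2) ↔ Odd (u x / 2 / 2)) then 1 else 0)) with hτ₀def
  have hτ₀val : ∀ x, τ₀ x = 1 ∨ τ₀ x = -1 ∨ τ₀ x = 3 ∨ τ₀ x = -3 := by
    intro x
    simp only [τ₀]
    rcases tp_sZ_cases (decide (Odd (u x / 2))) with h | h <;> rw [h] <;> split_ifs <;> norm_num
  have hτ₀sq : ∀ x, τ₀ x ^ 2 = 1 + 8 * (if (Odd (u x / 2) ↔ Odd (u x / 2 / 2)) then 1 else 0 : ℤ) := by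
    intro x
    simp only [τ₀]
    rcases tp_sZ_cases (decide (Odd (u x / 2))) with h | h <;> rw [h] <;> split_ifs <;> norm_num
  have hsumτ₀ : ∑ x, τ₀ x ^ 2 = 4096 + 8 * #E := by
    rw [sum_congr rfl fun x _ => hτ₀sq x, sum_add_distrib, ← mul_sum, hsumE, sum_const, card_univ, Fintype.card_fun,
      Fintype.card_bool, Fintype.card_fin]
    norm_num
  have hTge : ∑ x, τ₀ x ^ 2 ≤ (∑ x, (u x - 4 * sZ (f x)) ^ 2 : ℤ) := by
    refine sum_le_sum fun x _ => ?_
    rw [hv x]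
    linarith [to12_excess_nonneg (τ₀ x) (v x) (hτ₀val x)]
  have hE928le : #E ≤ 928 := by
    rw [hsumτ₀] at hTge
    have : (8 : ℤ) * #E ≤ 7424 := by linarith
    have : 8 * #E ≤ 7424 := by exact_mod_cast this
    omega
  -- `#E ∈ {904, 912, 920, 928}`; `904, 920` cost `≥ 256` more than available, `928` is `to18_typeO_E928_ge934_false`
  have hcases : #E = 904 ∨ #E = 912 ∨ #E = 920 ∨ #E = 928 := by omega
  rcases hcases with h | h | h | h
  · exfalso
    have hw := to18_typeO_w8_budget f g hf hg u hu hodd 56 (by rw [← hEdef]; rw [h])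
    rw [← hEdef, h] at hw
    have hT' : ((∑ x, (u x - 4 * sZ (f x)) ^ 2 : ℤ) : ℝ) ≤ 11520 := by exact_mod_cast hT
    norm_num at hw
    linarith [hbud]
  · exact h
  · exfalso
    have hw := to18_typeO_w8_budget f g hf hg u hu hodd 57 (by rw [← hEdef]; rw [h])
    rw [← hEdef, h] at hw
    have hT' : ((∑ x, (u x - 4 * sZ (f x)) ^ 2 : ℤ) : ℝ) ≤ 11520 := by exact_mod_cast hT
    norm_num at hw
    linarith [hbud]
  · exact (to18_typeO_E928_ge934_false f g hf hg u hu hodd (by rw [← hEdef]; exact h) hΦ).elim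

end Summit.QuantumAdvantage.QuantumAdvantage.Theorems.CubicForrelation.NearExactIsExact

end
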